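import Summits.CriticalPhenomena.PercolationContinuityZ3.Theorems.PercNearOneGluingNoHeavyLowerTailSahiLatinIndep

/-!
# `NoHeavyLowerTail` (crux stmt-CriticalPhenomena-4575), Sahi programme (prim-master-conj gen 43): ZEROS of the Latin kernel `κ_d`, III —
# the R/A-descent as a reachability relation, zero descent under FBP, and conjecture TZ with the zero-locus description it yields (every dimension)

Support file (`--supports stmt-CriticalPhenomena-4575`; sequel of `…SahiLatinZeros` and `…SahiLatinIndep`; memo
`run/shared/lean/prim/prim-l12/FROM-prim-master-conj-g43-ZERO-LOCUS.md`).  Vocabulary of `…SahiLatinKernel/Moves/Descent` (`Pt ι`, `kappa`,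
`Phi`, `IsMinOf`, `IsMaxOut`, `C1`, `C2`, `Terminal`, `UpTriple`, `LatinPos`) and `…SahiLatinIndep` (`AxisInessential`, `Indep`).

THE MATHEMATICS (all `d`; everything except the tagged conjecture is PROVED, axioms standard).
1. THE DESCENT AS A REACHABILITY RELATION: `Step` (one R-move — erase a minimal element of one slot lying in the two other sets — or one A-move —
   insert a maximal non-element of one slot not lying in both other sets), `Reach` (reflexive–transitive closure); `Step.up`, `Step.kappa_le`,
   `Reach.up`, `Reach.kappa_le`; **`exists_terminal_reach`**: every up-set triple REACHES a terminal up-set triple (the descent theorem of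
   `…SahiLatinDescent`, prim-master-conj gen 42, with the path recorded); **`Reach.kappa_eq_zero`**: under FBP everything reachable from a zero
   is a zero (every move on the way is cost-free, cf. the rigidity lemmas of `…SahiLatinZeros`); **`exists_terminal_zero_reach`**: under FBP every
   zero reaches a TERMINAL ZERO through zeros.
2. CONJECTURE TZ (`TerminalZerosIndep ι`, `@[conjecture]`, NOT asserted): every terminal triple of NONEMPTY PROPER up-sets with `κ = 0` is pairwise
   independent.  EVIDENCE (prim-master-conj gen 43, memo §2, code `code-g43/`): `d = 3` EXHAUSTIVE — the terminal zeros with three proper members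
   are exactly the 48 ordered triples of one-axis cylinders on three distinct axes; `d = 4, 5, 6`: 0 exceptions among ≈ 1.0·10⁶ / 9.6·10⁵ /
   3.7·10⁴ terminal zeros met by random R/A-descents with local search.  The degenerate slots need no conjecture: **`indep_of_terminal_zero`** —
   under TZ, EVERY terminal up-set triple with `κ = 0` is pairwise independent (an empty slot forces the others to be `⊤`,
   `eq_univ_of_C2_empty`; a full slot gives `κ(Ω,b,c) = 0 ⟹ b ⊥ c`, `indep_of_kappa_univ_eq_zero`).
3. THE ZERO LOCUS UNDER FBP + TZ: **`exists_indep_reach_of_zero`** — every zero of `κ` reaches, through cost-free moves only (every triple on the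
   way a zero), a pairwise independent terminal triple.  (`d = 3`: 16 932 ordered zeros with proper members, 810 of them WITHOUT an independent
   pair — the zero locus of the pattern functional is strictly larger than the 'independent pair + saturated' family of
   `…SahiGridPatternZeroLocus` (prim-sahi-p1 gen 14), and this is its structure; conversely pairwise independent proper triples are terminal zeros,
   `…SahiLatinIndep.terminal_of_indep` + `SahiGridPattern.sStarD_eq_zero_of_threeIndep`.)
HONEST LABEL: item 1 and `indep_of_terminal_zero`/`exists_indep_reach_of_zero` as IMPLICATIONS are theorems; TZ and FBP (`LatinPos ι`,
`|ι| ≥ 5`) are OPEN and enter only as hypotheses. [this work]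
-/

namespace Summit.CriticalPhenomena.PercolationContinuityZ3.Theorems.SahiLatin

open Finset

variable {ι : Type*} [Fintype ι] [DecidableEq ι]

/-! ## §1  The R/A-descent as a reachability relation -/

/-- A triple of subsets of `[3]^ι` (the three slots of `κ`). [this work] -/
abbrev Trip (ι : Type*) [Fintype ι] [DecidableEq ι] := Finset (Pt ι) × Finset (Pt ι) × Finset (Pt ι)

/-- The Latin kernel of a triple. [this work] -/
def Trip.kappa (s : Trip ι) : ℤ := SahiLatin.kappa s.1 s.2.1 s.2.2

/-- `UpTriple` of a triple. [this work] -/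
def Trip.Up (s : Trip ι) : Prop := UpTriple s.1 s.2.1 s.2.2

/-- `Terminal` of a triple. [this work] -/
def Trip.IsTerminal (s : Trip ι) : Prop := Terminal s.1 s.2.1 s.2.2

/-- **One move of the descent**: an R-move (erase a minimal element of one slot lying in the two other sets) or an A-move (insert a
maximal non-element of one slot not lying in both other sets), in any of the three slots. [this work] -/
inductive Step : Trip ι → Trip ι → Prop
  | eraseA {a b c : Finset (Pt ι)} {m : Pt ι} : IsMinOf a m → m ∈ b → m ∈ c → Step (a, b, c) (a.erase m, b, c)
  | eraseB {a b c : Finset (Pt ι)} {m : Pt ι} : IsMinOf b m → m ∈ a → m ∈ c → Step (a, b, c) (a, b.erase m, c)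
  | eraseC {a b c : Finset (Pt ι)} {m : Pt ι} : IsMinOf c m → m ∈ a → m ∈ b → Step (a, b, c) (a, b, c.erase m)
  | insertA {a b c : Finset (Pt ι)} {m : Pt ι} : IsMaxOut a m → ¬ (m ∈ b ∧ m ∈ c) → Step (a, b, c) (insert m a, b, c)
  | insertB {a b c : Finset (Pt ι)} {m : Pt ι} : IsMaxOut b m → ¬ (m ∈ a ∧ m ∈ c) → Step (a, b, c) (a, insert m b, c)
  | insertC {a b c : Finset (Pt ι)} {m : Pt ι} : IsMaxOut c m → ¬ (m ∈ a ∧ m ∈ b) → Step (a, b, c) (a, b, insert m c)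

/-- **Reachability** by descent moves (reflexive–transitive closure of `Step`). [this work] -/
def Reach : Trip ι → Trip ι → Prop := Relation.ReflTransGen Step

/-- A move keeps the three slots up-sets. [this work] -/
theorem Step.up {s t : Trip ι} (h : Step s t) (hs : s.Up) : t.Up := by
  cases h with
  | eraseA hm _ _ => exact ⟨isUpperSet_erase_of_minimal hs.1 hm.2, hs.2.1, hs.2.2⟩
  | eraseB hm _ _ => exact ⟨hs.1, isUpperSet_erase_of_minimal hs.2.1 hm.2, hs.2.2⟩
  | eraseC hm _ _ => exact ⟨hs.1, hs.2.1, isUpperSet_erase_of_minimal hs.2.2 hm.2⟩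
  | insertA hm _ => exact ⟨isUpperSet_insert_of_maximal hs.1 hm.2, hs.2.1, hs.2.2⟩
  | insertB hm _ => exact ⟨hs.1, isUpperSet_insert_of_maximal hs.2.1 hm.2, hs.2.2⟩
  | insertC hm _ => exact ⟨hs.1, hs.2.1, isUpperSet_insert_of_maximal hs.2.2 hm.2⟩

/-- A move from an up-set triple never increases `κ` (Lemmas R and A). [this work] -/
theorem Step.kappa_le {s t : Trip ι} (h : Step s t) (hs : s.Up) : t.kappa ≤ s.kappa := by
  cases h with
  | eraseA hm hb hc => exact kappa_erase_le hm.1 hb hc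
  | eraseB hm ha hc => exact kappa_erase_le₂ hm.1 ha hc
  | eraseC hm ha hb => exact kappa_erase_le₃ hm.1 ha hb
  | insertA hm hn => exact kappa_insert_le hs.2.1 hs.2.2 hm.1 hn
  | insertB hm hn => exact kappa_insert_le₂ hs.1 hs.2.2 hm.1 hn
  | insertC hm hn => exact kappa_insert_le₃ hs.1 hs.2.1 hm.1 hn

/-- Reachable triples are up-set triples. [this work] -/
theorem Reach.up {s t : Trip ι} (h : Reach s t) (hs : s.Up) : t.Up := by
  induction h with
  | refl => exact hs
  | tail _ hst ih => exact hst.up ih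

/-- `κ` is non-increasing along the descent. [this work] -/
theorem Reach.kappa_le {s t : Trip ι} (h : Reach s t) (hs : s.Up) : t.kappa ≤ s.kappa := by
  induction h with
  | refl => exact le_rfl
  | tail hs' hst ih => exact (hst.kappa_le (Reach.up hs' hs)).trans ih

/-- Phase A with the path recorded (strong induction on `|aᶜ| + |bᶜ| + |cᶜ|`). [this work] -/
theorem exists_terminal_reach_of_C1 : ∀ (n : ℕ) (a b c : Finset (Pt ι)), aᶜ.card + bᶜ.card + cᶜ.card = n → UpTriple a b c →
    C1 a b c → C1 b a c → C1 c a b →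
    ∃ a' b' c' : Finset (Pt ι), UpTriple a' b' c' ∧ Terminal a' b' c' ∧ Reach (a, b, c) (a', b', c') := by
  intro n
  induction n using Nat.strong_induction_on with
  | _ n ih =>
    intro a b c hn hup h1a h1b h1c
    obtain ⟨ha, hb, hc⟩ := hup
    by_cases hA : ∃ m, IsMaxOut a m ∧ ¬ (m ∈ b ∧ m ∈ c)
    · obtain ⟨m, hm, hmbc⟩ := hA
      have hlt : (insert m a)ᶜ.card + bᶜ.card + cᶜ.card < n := by
        have := card_compl_insert_lt hm.1; omega
      obtain ⟨a', b', c', hup', hT, hR⟩ := ih _ hlt (insert m a) b c rfl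
        ⟨isUpperSet_insert_of_maximal ha hm.2, hb, hc⟩ (C1_insert_left h1a hmbc) (C1_insert_mid h1b hmbc)
        (C1_insert_mid h1c fun h => hmbc ⟨h.2, h.1⟩)
      exact ⟨a', b', c', hup', hT, Relation.ReflTransGen.head (Step.insertA hm hmbc) hR⟩
    by_cases hB : ∃ m, IsMaxOut b m ∧ ¬ (m ∈ a ∧ m ∈ c)
    · obtain ⟨m, hm, hmac⟩ := hB
      have hlt : aᶜ.card + (insert m b)ᶜ.card + cᶜ.card < n := by
        have := card_compl_insert_lt hm.1; omega
      obtain ⟨a', b', c', hup', hT, hR⟩ := ih _ hlt a (insert m b) c rfl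
        ⟨ha, isUpperSet_insert_of_maximal hb hm.2, hc⟩ (C1_insert_mid h1a hmac) (C1_insert_left h1b hmac)
        (C1_insert_right h1c fun h => hmac ⟨h.2, h.1⟩)
      exact ⟨a', b', c', hup', hT, Relation.ReflTransGen.head (Step.insertB hm hmac) hR⟩
    by_cases hC : ∃ m, IsMaxOut c m ∧ ¬ (m ∈ a ∧ m ∈ b)
    · obtain ⟨m, hm, hmab⟩ := hC
      have hlt : aᶜ.card + bᶜ.card + (insert m c)ᶜ.card < n := by
        have := card_compl_insert_lt hm.1; omega
      obtain ⟨a', b', c', hup', hT, hR⟩ := ih _ hlt a b (insert m c) rfl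
        ⟨ha, hb, isUpperSet_insert_of_maximal hc hm.2⟩ (C1_insert_right h1a hmab) (C1_insert_right h1b fun h => hmab ⟨h.2, h.1⟩)
        (C1_insert_left h1c hmab)
      exact ⟨a', b', c', hup', hT, Relation.ReflTransGen.head (Step.insertC hm hmab) hR⟩
    push Not at hA hB hC
    exact ⟨a, b, c, ⟨ha, hb, hc⟩, ⟨h1a, h1b, h1c, hA, hB, hC⟩, Relation.ReflTransGen.refl⟩

/-- The full descent with the path recorded (strong induction on `|a| + |b| + |c|` for phase R, then phase A). [this work] -/
theorem exists_terminal_reach_aux : ∀ (n : ℕ) (a b c : Finset (Pt ι)), a.card + b.card + c.card = n → UpTriple a b c →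
    ∃ a' b' c' : Finset (Pt ι), UpTriple a' b' c' ∧ Terminal a' b' c' ∧ Reach (a, b, c) (a', b', c') := by
  intro n
  induction n using Nat.strong_induction_on with
  | _ n ih =>
    intro a b c hn hup
    obtain ⟨ha, hb, hc⟩ := hup
    by_cases hA : ∃ m, IsMinOf a m ∧ (m ∈ b ∧ m ∈ c)
    · obtain ⟨m, hm, hmb, hmc⟩ := hA
      have hlt : (a.erase m).card + b.card + c.card < n := by
        have := card_erase_lt_of_mem hm.1; omega
      obtain ⟨a', b', c', hup', hT, hR⟩ := ih _ hlt (a.erase m) b c rfl ⟨isUpperSet_erase_of_minimal ha hm.2, hb, hc⟩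
      exact ⟨a', b', c', hup', hT, Relation.ReflTransGen.head (Step.eraseA hm hmb hmc) hR⟩
    by_cases hB : ∃ m, IsMinOf b m ∧ (m ∈ a ∧ m ∈ c)
    · obtain ⟨m, hm, hma, hmc⟩ := hB
      have hlt : a.card + (b.erase m).card + c.card < n := by
        have := card_erase_lt_of_mem hm.1; omega
      obtain ⟨a', b', c', hup', hT, hR⟩ := ih _ hlt a (b.erase m) c rfl ⟨ha, isUpperSet_erase_of_minimal hb hm.2, hc⟩
      exact ⟨a', b', c', hup', hT, Relation.ReflTransGen.head (Step.eraseB hm hma hmc) hR⟩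
    by_cases hC : ∃ m, IsMinOf c m ∧ (m ∈ a ∧ m ∈ b)
    · obtain ⟨m, hm, hma, hmb⟩ := hC
      have hlt : a.card + b.card + (c.erase m).card < n := by
        have := card_erase_lt_of_mem hm.1; omega
      obtain ⟨a', b', c', hup', hT, hR⟩ := ih _ hlt a b (c.erase m) rfl ⟨ha, hb, isUpperSet_erase_of_minimal hc hm.2⟩
      exact ⟨a', b', c', hup', hT, Relation.ReflTransGen.head (Step.eraseC hm hma hmb) hR⟩
    push Not at hA hB hC
    exact exists_terminal_reach_of_C1 _ a b c rfl ⟨ha, hb, hc⟩ (fun m hm h => hA m hm h.1 h.2) (fun m hm h => hB m hm h.1 h.2)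
      (fun m hm h => hC m hm h.1 h.2)

/-- **DESCENT THEOREM with the path** (all `d`): every triple of up-sets of `[3]^ι` REACHES, by R-moves and A-moves, a terminal
triple of up-sets; `κ` does not increase along the way (`Reach.kappa_le`). [this work] -/
theorem exists_terminal_reach {a b c : Finset (Pt ι)} (hup : UpTriple a b c) :
    ∃ a' b' c' : Finset (Pt ι), UpTriple a' b' c' ∧ Terminal a' b' c' ∧ Reach (a, b, c) (a', b', c') :=
  exists_terminal_reach_aux _ a b c rfl hup

/-- **Under FBP everything reachable from a zero is a zero** (every move along the way is cost-free). [this work] -/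
theorem Reach.kappa_eq_zero (hL : LatinPos ι) {s t : Trip ι} (h : Reach s t) (hs : s.Up) (h0 : s.kappa = 0) : t.kappa = 0 := by
  have h1 : t.kappa ≤ 0 := h0 ▸ h.kappa_le hs
  have hup := h.up hs
  have h2 : 0 ≤ t.kappa := hL _ _ _ hup
  exact le_antisymm h1 h2

/-- **Every zero descends to a TERMINAL ZERO through zeros** (under FBP). [this work] -/
theorem exists_terminal_zero_reach (hL : LatinPos ι) {a b c : Finset (Pt ι)} (hup : UpTriple a b c) (h0 : kappa a b c = 0) :
    ∃ a' b' c' : Finset (Pt ι), UpTriple a' b' c' ∧ Terminal a' b' c' ∧ Reach (a, b, c) (a', b', c') ∧ kappa a' b' c' = 0 := by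
  obtain ⟨a', b', c', hup', hT, hR⟩ := exists_terminal_reach hup
  exact ⟨a', b', c', hup', hT, hR, hR.kappa_eq_zero hL (s := (a, b, c)) hup h0⟩

/-! ## §2  Conjecture TZ (typed, not asserted); degenerate slots; the zero-locus description -/

/-- **CONJECTURE TZ** (prim-master-conj gen 43; typed as a `Prop`, NEVER asserted): every TERMINAL triple of nonempty proper up-sets of
`[3]^ι` with `κ = 0` is pairwise independent.  Evidence: `d = 3` exhaustive (the terminal zeros with proper members are the 48 ordered triples
of one-axis cylinders on three distinct axes), `d = 4, 5, 6`: no exception among ≈ 2·10⁶ terminal zeros met by random descents.  An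
obligation / hypothesis, never a fact. [this work] [status: open] -/
@[conjecture] def TerminalZerosIndep (ι : Type*) [Fintype ι] [DecidableEq ι] : Prop :=
  ∀ a b c : Finset (Pt ι), UpTriple a b c → a.Nonempty → a ≠ univ → b.Nonempty → b ≠ univ → c.Nonempty → c ≠ univ →
    Terminal a b c → kappa a b c = 0 → Indep a b ∧ Indep a c ∧ Indep b c

/-- **Degenerate slots need no conjecture**: under TZ, EVERY terminal up-set triple with `κ = 0` (empty or full slots allowed) is pairwise
independent. [this work] -/
theorem indep_of_terminal_zero (hTZ : TerminalZerosIndep ι) {a b c : Finset (Pt ι)} (hup : UpTriple a b c) (hT : Terminal a b c)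
    (h0 : kappa a b c = 0) : Indep a b ∧ Indep a c ∧ Indep b c := by
  -- empty slots force the other two slots to be `⊤`
  by_cases ha : a = ∅
  · subst ha
    have hb : b = univ := eq_univ_of_C2_empty hT.c2b
    have hc : c = univ := eq_univ_of_C2_empty hT.c2c
    subst hb; subst hc
    exact ⟨indep_empty_left _, indep_empty_left _, indep_univ_left _⟩
  by_cases hb : b = ∅
  · subst hb
    have ha' : a = univ := eq_univ_of_C2_empty hT.c2a
    have hc : c = univ := eq_univ_of_C2_empty_right hT.c2c
    subst ha'; subst hc
    exact ⟨indep_univ_left _, indep_univ_left _, indep_empty_left _⟩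
  by_cases hc : c = ∅
  · subst hc
    have ha' : a = univ := eq_univ_of_C2_empty_right hT.c2a
    have hb' : b = univ := eq_univ_of_C2_empty_right hT.c2b
    subst ha'; subst hb'
    exact ⟨indep_univ_left _, indep_univ_left _, indep_univ_left _⟩
  -- full slots: the equality case of coefficientwise Harris in the complementary pair
  by_cases hau : a = univ
  · subst hau
    exact ⟨indep_univ_left _, indep_univ_left _, indep_of_kappa_univ_eq_zero hup.2.1 hup.2.2 h0⟩
  by_cases hbu : b = univ
  · subst hbu
    have h0' : kappa univ a c = 0 := by rw [kappa_swap12]; exact h0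
    exact ⟨(indep_univ_left a).symm, indep_of_kappa_univ_eq_zero hup.1 hup.2.2 h0', indep_univ_left _⟩
  by_cases hcu : c = univ
  · subst hcu
    have h0' : kappa univ b a = 0 := by rw [kappa_swap13]; exact h0
    exact ⟨(indep_of_kappa_univ_eq_zero hup.2.1 hup.1 h0').symm, (indep_univ_left a).symm, (indep_univ_left b).symm⟩
  exact hTZ a b c hup (nonempty_iff_ne_empty.2 ha) hau (nonempty_iff_ne_empty.2 hb) hbu (nonempty_iff_ne_empty.2 hc) hcu hT h0

/-- **THE ZERO LOCUS UNDER FBP + TZ** (all `d`): every zero of the Latin kernel reaches, through cost-free R- and A-moves only (every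
triple on the way is again a zero, `Reach.kappa_eq_zero`), a pairwise independent terminal triple. [this work] -/
theorem exists_indep_reach_of_zero (hL : LatinPos ι) (hTZ : TerminalZerosIndep ι) {a b c : Finset (Pt ι)} (hup : UpTriple a b c)
    (h0 : kappa a b c = 0) :
    ∃ a' b' c' : Finset (Pt ι), UpTriple a' b' c' ∧ Terminal a' b' c' ∧ Reach (a, b, c) (a', b', c') ∧ kappa a' b' c' = 0 ∧
      Indep a' b' ∧ Indep a' c' ∧ Indep b' c' := by
  obtain ⟨a', b', c', hup', hT, hR, h0'⟩ := exists_terminal_zero_reach hL hup h0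
  exact ⟨a', b', c', hup', hT, hR, h0', indep_of_terminal_zero hTZ hup' hT h0'⟩

end Summit.CriticalPhenomena.PercolationContinuityZ3.Theorems.SahiLatin
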